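import Literature.Barriers.RiemannHypothesis.DeBrangesPositivityDirichlet
import Literature.Barriers.RiemannHypothesis.DeBrangesPositivityProofs
import Literature.Analysis.DeBrangesSpaces.ConreyLi2000SpacesFW
import Mathlib.NumberTheory.LSeries.Nonvanishing
import HarnessLib

/-!
# Discharge of `ConreyLi2000_FW_char` (Conrey–Li 2000, §4 Remark: P. Sarnak's proof, every Dirichlet character)

LABEL (line 1): RH-FREE NEGATIVE result, PROVED: for every `r ≥ 1` and every Dirichlet character
`χ` mod `r` there is `s₀` with `Re s₀ > 1` (hence `> 1/2`) and `Re{ξ(s₀, χ)/ξ(s₀+1, χ)} < 0`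
(`ξ(·, χ) = Literature.NumberTheory.LFunctions.DirichletTheta.dirichletXi χ`, exactly Conrey–Li's
§4 normalisation), i.e. the necessary condition of de Branges' Theorem 2 (Conrey–Li 2000, Thm. 2)
fails for `W_χ(z) = 1/ξ(1 − iz, χ)`. bears_on: B-C/B-P (LADDER-RH §1, COLUMN 6 DBR). WHAT THIS IS NOT:
not progress toward RH/GRH — it is the formal proof of a printed refutation of de Branges'
sufficient condition (3.8); nothing here bears on the truth of RH.

## The printed proof and the proof formalised here

Conrey–Li (IMRN 2000:18, §4 Remark; arXiv:math/9812166 p. 4) print Sarnak's argument for `ζ`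
(`Im log(ξ(s)/ξ(s+1)) = Im log ζ(s) + O(1)`, density of the values of `log ζ(s)`,
`1/2 < Re s < 2`, Titchmarsh Ch. XI) and add: "By using a similar argument, Peter Sarnak also
proved that the space `𝓕(W_χ)` does not satisfy the condition (3.8) where `W_χ(z) = 1/ξ(1−iz, χ)`",
`ξ(s, χ) = (π/r)^{−(s+a)/2} Γ((s+a)/2) L(s, χ)`. No source for the `χ`-analogue of the density
theorem is printed. As for the tree's `ζ` proof `ConreyLi2000_FW_holds`
(`DeBrangesPositivityProofs.lean`, whose lemmas are reused), the architecture is kept and the two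
analytic inputs are replaced by elementary ones on vertical lines `Re s = σ > 1`:

* the Gamma factor cancels over two shifts: `Γ_ℝ(s+a+2) = Γ_ℝ(s+a)(s+a)/(2π)` gives
  `ξ(s, χ)/ξ(s+2, χ) = 2π L(s, χ)/(r (s+a) L(s+2, χ))` (`xi_div_xi_add_two`), so with
  `E_χ(s) = ∑_p −log(1 − χ(p)p^{−s}) = log L(s, χ)` (Mathlib's Euler product,
  `DirichletCharacter.LSeries_eulerProduct_exp_log`) one has `F(s)F(s+1) = exp Ψ_χ(s)`,
  `Ψ_χ(s) = log(2π/r) − log(s+a) + E_χ(s) − E_χ(s+2)` (`exp_psi`);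
* if `Re F ≥ 0` on `Re s > 1`, a continuous branch of `log F(s) + log F(s+1)` along the line has
  `|Im| ≤ π`, so `Im Ψ_χ` oscillates by at most `2π` and `Y(t) = Im(E_χ(σ+it) − E_χ(σ+it+2))` by at
  most `4π` (`abs_im_sub_im_le`; one `arg` instead of three);
* Bohr's density theorem is replaced by Kronecker's theorem for the prime phases with unimodular
  targets (`Kronecker.exists_abs_ge_forall_prime_norm_cpow_sub_lt`): aligning `χ(p)p^{−it₁} ≈ −i`
  and `χ(p)p^{−it₂} ≈ +i` for the primes `p < n`, `p ∤ r`, gives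
  `Y(t₂) − Y(t₁) ≥ 3H′ − 2S − 4C` with `H′ = ∑_{p<n, p∤r} p^{−σ} ≥ H − r`, which exceeds `4π` for
  `σ` near `1` and `n` large (`∑ 1/p = ∞`; `ConreyLi2000.exists_sigma_n`). Contradiction.

Also proved: GIVEN Conrey–Li's Theorem 2 (`Literature.Analysis.DeBrangesSpaces.conreyLi2000_thm2`,
a named fact), the printed conclusion itself — no kernel-shift transformation `T` of `𝓕(W_χ)`
satisfies (3.8) (`not_positivity_spaceF_char`).

## References

* [ConreyLi2000] J. B. Conrey, X.-J. Li, IMRN 2000:18, 929–940 = arXiv:math/9812166, §4 Remark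
  (read, arXiv p. 4).
* [Titchmarsh1986] E. C. Titchmarsh, *The Theory of the Riemann Zeta-function*, 2nd ed., §8.6
  (Bohr's method with Kronecker's theorem — the argument of `ConreyLi2000.exists_sigma_n`), Ch. XI.
* [MontgomeryVaughan2007] H. L. Montgomery, R. C. Vaughan, *Multiplicative Number Theory I*, (10.19).
-/

noncomputable section

open Complex Filter Topology Finset
open scoped Real ComplexConjugate

open Literature.NumberTheory.LFunctions Literature.NumberTheory.LFunctions.Nicolas
  Literature.NumberTheory.LFunctions.DirichletTheta Literature.NumberTheory.DiophantineApproximation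

namespace Literature.Barriers.RiemannHypothesis

namespace ConreyLi2000Char

variable {N : ℕ} [NeZero N] (χ : DirichletCharacter ℂ N)

/-! ### `log L(s, χ)` as a prime sum on `Re s > 1` -/

/-- `E_χ(s) = ∑_p −log(1 − χ(p) p^{−s})`, the logarithm of the Euler product of `L(s, χ)`
(`Re s > 1`). [cite: MontgomeryVaughan2007, §1.3] -/
def charPrimeLog (χ : DirichletCharacter ℂ N) (s : ℂ) : ℂ :=
  ∑' p : Nat.Primes, -log (1 - χ p * ((p : ℕ) : ℂ) ^ (-s))

omit [NeZero N] in
/-- `‖χ(p) p^{−s}‖ ≤ p^{−Re s}`. [folklore] -/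
private theorem norm_chi_mul_cpow_le (p : Nat.Primes) (s : ℂ) :
    ‖χ p * ((p : ℕ) : ℂ) ^ (-s)‖ ≤ ((p : ℕ) : ℝ) ^ (-s.re) := by
  rw [norm_mul, norm_primes_cpow_neg]
  exact mul_le_of_le_one_left (Real.rpow_nonneg (Nat.cast_nonneg _) _) (χ.norm_le_one _)

omit [NeZero N] in
/-- Termwise bound `‖log(1 − χ(p)p^{−w})‖ ≤ (3/2) p^{−η}` for `Re w ≥ η ≥ 1`. [folklore] -/
private theorem norm_term_le (p : Nat.Primes) {w : ℂ} {η : ℝ} (hη : 1 ≤ η) (hw : η ≤ w.re) :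
    ‖-log (1 - χ p * ((p : ℕ) : ℂ) ^ (-w))‖ ≤ 3 / 2 * ((p : ℕ) : ℝ) ^ (-η) := by
  have hp1 : (1 : ℝ) ≤ ((p : ℕ) : ℝ) := by exact_mod_cast p.2.one_lt.le
  have hp2 : (2 : ℝ) ≤ ((p : ℕ) : ℝ) := by exact_mod_cast p.2.two_le
  have hz : ‖χ p * ((p : ℕ) : ℂ) ^ (-w)‖ ≤ ((p : ℕ) : ℝ) ^ (-η) :=
    (norm_chi_mul_cpow_le χ p w).trans (Real.rpow_le_rpow_of_exponent_le hp1 (by linarith))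
  have h1 : ‖-(χ p * ((p : ℕ) : ℂ) ^ (-w))‖ ≤ 1 / 2 := by
    rw [norm_neg]
    refine hz.trans ?_
    calc ((p : ℕ) : ℝ) ^ (-η) ≤ ((p : ℕ) : ℝ) ^ (-1 : ℝ) :=
          Real.rpow_le_rpow_of_exponent_le hp1 (by linarith)
      _ = ((p : ℕ) : ℝ)⁻¹ := Real.rpow_neg_one _
      _ ≤ 2⁻¹ := inv_anti₀ two_pos hp2
      _ = 1 / 2 := by norm_num
  rw [norm_neg, sub_eq_add_neg]
  refine (norm_log_one_add_half_le_self h1).trans ?_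
  rw [norm_neg]
  linarith

omit [NeZero N] in
/-- The terms of `E_χ` are summable for `Re s > 1` (Mathlib). [folklore] -/
private theorem summable_terms {s : ℂ} (hs : 1 < s.re) :
    Summable fun p : Nat.Primes ↦ -log (1 - χ p * ((p : ℕ) : ℂ) ^ (-s)) :=
  DirichletCharacter.summable_neg_log_one_sub_mul_prime_cpow χ hs

/-- `exp E_χ(s) = L(s, χ)` for `Re s > 1` (Mathlib's Euler product).
[cite: MontgomeryVaughan2007, §1.3] -/
theorem exp_charPrimeLog {s : ℂ} (hs : 1 < s.re) : cexp (charPrimeLog χ s) = χ.LFunction s := by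
  rw [charPrimeLog, DirichletCharacter.LFunction_eq_LSeries χ hs]
  exact DirichletCharacter.LSeries_eulerProduct_exp_log χ hs

omit [NeZero N] in
/-- Continuity of `E_χ` along any continuous path staying in `Re s ≥ σ > 1` (uniform convergence:
terms bounded by `(3/2) p^{−σ}`). [folklore] -/
private theorem continuous_charPrimeLog_comp {g : ℝ → ℂ} (hg : Continuous g) {σ : ℝ} (hσ : 1 < σ)
    (hgre : ∀ τ, σ ≤ (g τ).re) : Continuous fun τ ↦ charPrimeLog χ (g τ) := by
  unfold charPrimeLog
  refine continuous_tsum (fun p ↦ ?_) ((summable_primes_rpow_neg hσ).mul_left (3 / 2))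
    (fun p τ ↦ norm_term_le χ p hσ.le (hgre τ))
  have hp1 : (1 : ℝ) < ((p : ℕ) : ℝ) := by exact_mod_cast p.2.one_lt
  have h1 : Continuous fun τ ↦ 1 - χ p * ((p : ℕ) : ℂ) ^ (-(g τ)) :=
    continuous_const.sub (continuous_const.mul ((differentiable_primes_cpow_neg p).continuous.comp hg))
  refine (h1.clog fun τ ↦ ?_).neg
  rw [sub_eq_add_neg]
  refine mem_slitPlane_of_norm_lt_one ?_
  rw [norm_neg]
  exact (norm_chi_mul_cpow_le χ p _).trans_lt
    (Real.rpow_lt_one_of_one_lt_of_neg hp1 (by linarith [hgre τ]))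

/-! ### `ξ(s, χ)` on `Re s > 1`: product formula, non-vanishing, the Gamma-free double ratio -/

/-- `ξ(s, χ) = r^{(s+a)/2} Γ_ℝ(s+a) L(s, χ)` for `Re s > 1`. [cite: MontgomeryVaughan2007, (10.19)] -/
theorem dirichletXi_eq_mul_LFunction {s : ℂ} (hs : 1 < s.re) :
    dirichletXi χ s = (N : ℂ) ^ ((s + charParity χ) / 2) *
      (Gammaℝ (s + charParity χ) * χ.LFunction s) := by
  have h0 : s ≠ 0 := by rintro rfl; norm_num at hs
  have hre : 0 < (s + charParity χ).re := by
    simp only [add_re, natCast_re]; positivity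
  have hG : Gammaℝ (s + charParity χ) ≠ 0 := Gammaℝ_ne_zero_of_re_pos hre
  have hL : χ.completedLFunction s = Gammaℝ (s + charParity χ) * χ.LFunction s := by
    rw [DirichletCharacter.LFunction_eq_completed_div_gammaFactor χ s (Or.inl h0),
      gammaFactor_eq_Gammaℝ, mul_div_cancel₀ _ hG]
  rw [dirichletXi_def, hL]

/-- `ξ(s, χ) ≠ 0` for `Re s > 1` (Euler product). [cite: MontgomeryVaughan2007, (10.19)] -/
theorem dirichletXi_ne_zero {s : ℂ} (hs : 1 < s.re) : dirichletXi χ s ≠ 0 := by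
  have h1 : s ≠ 1 := by rintro rfl; norm_num at hs
  have hre : 0 < (s + charParity χ).re := by
    simp only [add_re, natCast_re]; positivity
  have hN : (N : ℂ) ≠ 0 := by exact_mod_cast NeZero.ne N
  rw [dirichletXi_eq_mul_LFunction χ hs]
  refine mul_ne_zero ?_ (mul_ne_zero (Gammaℝ_ne_zero_of_re_pos hre)
    (DirichletCharacter.LFunction_ne_zero_of_one_le_re χ (Or.inr h1) hs.le))
  rw [Ne, cpow_eq_zero_iff, not_and_or]
  exact Or.inl hN

/-- `ξ(·, χ)` is complex-differentiable at every `s` with `Re s > 1` (all `χ`, including the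
principal ones: the poles of `Λ(·, χ₀)` are at `s = 0, 1`). [cite: MontgomeryVaughan2007, (10.19)] -/
theorem differentiableAt_dirichletXi_of_one_lt_re {s : ℂ} (hs : 1 < s.re) :
    DifferentiableAt ℂ (dirichletXi χ) s := by
  have h0 : s ≠ 0 := by rintro rfl; norm_num at hs
  have h1 : s ≠ 1 := by rintro rfl; norm_num at hs
  have hN : (N : ℂ) ≠ 0 := by exact_mod_cast NeZero.ne N
  have hc : DifferentiableAt ℂ (fun s : ℂ ↦ (N : ℂ) ^ ((s + charParity χ) / 2)) s := by
    refine DifferentiableAt.const_cpow ?_ (Or.inl hN)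
    fun_prop
  have := hc.mul (DirichletCharacter.differentiableAt_completedLFunction χ s (Or.inl h0) (Or.inl h1))
  exact this.congr_of_eventuallyEq (Eventually.of_forall fun s ↦ (dirichletXi_def χ s))

/-- **The Gamma factor cancels over two shifts**: for `Re s > 1`,
`ξ(s, χ)/ξ(s+2, χ) = 2π L(s, χ) / (r (s+a) L(s+2, χ))`, by `Γ_ℝ(u+2) = Γ_ℝ(u) u/(2π)` — this removes
the printed `O(1)` of `Im log(ξ(s)/ξ(s+1)) = Im log L(s) + O(1)`. [cite: ConreyLi2000, §4 Remark] -/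
theorem xi_div_xi_add_two {s : ℂ} (hs : 1 < s.re) :
    dirichletXi χ s / dirichletXi χ (s + 2) =
      2 * π * χ.LFunction s / ((N : ℂ) * (s + charParity χ) * χ.LFunction (s + 2)) := by
  have hs2 : 1 < (s + 2).re := by simp only [add_re, re_ofNat]; linarith
  have hre : 0 < (s + charParity χ).re := by
    simp only [add_re, natCast_re]; positivity
  have hsa : s + charParity χ ≠ 0 := by
    intro h; rw [h] at hre; simp at hre
  have hN : (N : ℂ) ≠ 0 := by exact_mod_cast NeZero.ne N
  have hG : Gammaℝ (s + charParity χ) ≠ 0 := Gammaℝ_ne_zero_of_re_pos hre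
  have hL2 : χ.LFunction (s + 2) ≠ 0 :=
    DirichletCharacter.LFunction_ne_zero_of_one_le_re χ
      (Or.inr (by intro h; have := congrArg re h; simp at this; linarith)) hs2.le
  have hπ : (Real.pi : ℂ) ≠ 0 := ofReal_ne_zero.2 Real.pi_ne_zero
  have hc : (N : ℂ) ^ ((s + charParity χ) / 2) ≠ 0 := by
    rw [Ne, cpow_eq_zero_iff, not_and_or]; exact Or.inl hN
  have e1 : s + 2 + (charParity χ : ℂ) = s + charParity χ + 2 := by ring
  have e2 : (N : ℂ) ^ ((s + charParity χ + 2) / 2) = (N : ℂ) ^ ((s + charParity χ) / 2) * N := by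
    rw [show (s + charParity χ + 2) / 2 = (s + charParity χ) / 2 + 1 by ring, cpow_add _ _ hN,
      cpow_one]
  rw [dirichletXi_eq_mul_LFunction χ hs, dirichletXi_eq_mul_LFunction χ hs2, e1,
    Gammaℝ_add_two hsa, e2]
  field_simp

/-- **`F(s)F(s+1) = ξ(s, χ)/ξ(s+2, χ) = exp Ψ_χ(s)`** on `Re s > 1`, with the explicit logarithm
`Ψ_χ(s) = log(2π/r) − log(s+a) + E_χ(s) − E_χ(s+2)`. [cite: ConreyLi2000, §4 Remark] -/
theorem exp_psi {s : ℂ} (hs : 1 < s.re) :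
    cexp (((Real.log (2 * Real.pi / N) : ℝ) : ℂ) - log (s + charParity χ)
      + (charPrimeLog χ s - charPrimeLog χ (s + 2))) = dirichletXi χ s / dirichletXi χ (s + 2) := by
  have hs2 : 1 < (s + 2).re := by simp only [add_re, re_ofNat]; linarith
  have hre : 0 < (s + charParity χ).re := by
    simp only [add_re, natCast_re]; positivity
  have hsa : s + charParity χ ≠ 0 := by
    intro h; rw [h] at hre; simp at hre
  have hN : (N : ℂ) ≠ 0 := by exact_mod_cast NeZero.ne N
  have hNpos : (0 : ℝ) < N := by exact_mod_cast Nat.pos_of_ne_zero (NeZero.ne N)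
  have hL2 : χ.LFunction (s + 2) ≠ 0 :=
    DirichletCharacter.LFunction_ne_zero_of_one_le_re χ
      (Or.inr (by intro h; have := congrArg re h; simp at this; linarith)) hs2.le
  simp only [Complex.exp_add, Complex.exp_sub]
  rw [exp_log hsa, exp_charPrimeLog χ hs, exp_charPrimeLog χ hs2, ← ofReal_exp,
    Real.exp_log (by positivity), xi_div_xi_add_two χ hs]
  push_cast
  field_simp

/-! ### Under the positivity hypothesis, `Im (E_χ(s_t) − E_χ(s_t+2))` has oscillation `≤ 4π` -/

/-- **The bounded-argument step of Sarnak's proof, for `χ`.** If `Re{ξ(s, χ)/ξ(s+1, χ)} ≥ 0` for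
all `Re s > 1`, then for every `σ > 1` the function `Y(t) = Im (E_χ(σ+it) − E_χ(σ+it+2))`
satisfies `|Y(t) − Y(t')| ≤ 4π` for all real `t, t'`. [cite: ConreyLi2000, §4 Remark] -/
theorem abs_im_sub_im_le
    (H0 : ∀ s : ℂ, 1 < s.re → 0 ≤ (dirichletXi χ s / dirichletXi χ (s + 1)).re)
    {σ : ℝ} (hσ : 1 < σ) (t t' : ℝ) :
    |(charPrimeLog χ ((σ : ℂ) + t * I) - charPrimeLog χ ((σ : ℂ) + t * I + 2)).im
      - (charPrimeLog χ ((σ : ℂ) + t' * I) - charPrimeLog χ ((σ : ℂ) + t' * I + 2)).im|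
      ≤ 4 * Real.pi := by
  set L : ℝ → ℂ := fun τ ↦ (σ : ℂ) + τ * I with hL
  have hLre : ∀ τ, (L τ).re = σ := by intro τ; simp [hL]
  have hLc : Continuous L := by rw [hL]; fun_prop
  -- real parts along the line
  have hre0 : ∀ τ, 1 < (L τ).re := fun τ ↦ by rw [hLre]; exact hσ
  have hre1 : ∀ τ, 1 < (L τ + 1).re := fun τ ↦ by simp [hL]; linarith
  have hre2 : ∀ τ, 1 < (L τ + 2).re := fun τ ↦ by simp [hL]; linarith
  have hre11 : ∀ τ, 1 < (L τ + 1 + 1).re := fun τ ↦ by simp [hL]; linarith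
  have hrea : ∀ τ, 0 < (L τ + charParity χ).re := fun τ ↦ by
    simp only [add_re, natCast_re, hLre]; positivity
  -- continuity of `ξ(·, χ)` along the (shifted) lines: differentiable at points with `Re s > 1`
  have hξc : ∀ g : ℝ → ℂ, Continuous g → (∀ τ, 1 < (g τ).re) →
      Continuous fun τ ↦ dirichletXi χ (g τ) := fun g hg hgre ↦
    continuous_iff_continuousAt.2 fun τ ↦
      (differentiableAt_dirichletXi_of_one_lt_re χ (hgre τ)).continuousAt.comp hg.continuousAt
  -- the two branches `u` (from the hypothesis) and `v` (explicit)
  set f : ℂ → ℂ := fun s ↦ dirichletXi χ s / dirichletXi χ (s + 1) with hf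
  have hf0 : ∀ τ, f (L τ) ≠ 0 := fun τ ↦
    div_ne_zero (dirichletXi_ne_zero χ (hre0 τ)) (dirichletXi_ne_zero χ (hre1 τ))
  have hf1 : ∀ τ, f (L τ + 1) ≠ 0 := fun τ ↦
    div_ne_zero (dirichletXi_ne_zero χ (hre1 τ)) (dirichletXi_ne_zero χ (hre11 τ))
  have hfc0 : Continuous fun τ ↦ f (L τ) :=
    (hξc L hLc hre0).div (hξc (fun τ ↦ L τ + 1) (hLc.add continuous_const) hre1)
      fun τ ↦ dirichletXi_ne_zero χ (hre1 τ)
  have hfc1 : Continuous fun τ ↦ f (L τ + 1) :=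
    (hξc (fun τ ↦ L τ + 1) (hLc.add continuous_const) hre1).div
      (hξc (fun τ ↦ L τ + 1 + 1) ((hLc.add continuous_const).add continuous_const) hre11)
      fun τ ↦ dirichletXi_ne_zero χ (hre11 τ)
  have hpos0 : ∀ τ, 0 ≤ (f (L τ)).re := fun τ ↦ H0 _ (hre0 τ)
  have hpos1 : ∀ τ, 0 ≤ (f (L τ + 1)).re := fun τ ↦ H0 _ (hre1 τ)
  set u : ℝ → ℂ := fun τ ↦ log (f (L τ)) + log (f (L τ + 1)) with hu
  set v : ℝ → ℂ := fun τ ↦ ((Real.log (2 * Real.pi / N) : ℝ) : ℂ) - log (L τ + charParity χ)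
      + (charPrimeLog χ (L τ) - charPrimeLog χ (L τ + 2)) with hv
  have huc : Continuous u :=
    (hfc0.clog fun τ ↦ ConreyLi2000.mem_slitPlane_of_re_nonneg (hpos0 τ) (hf0 τ)).add
      (hfc1.clog fun τ ↦ ConreyLi2000.mem_slitPlane_of_re_nonneg (hpos1 τ) (hf1 τ))
  have hvc : Continuous v := by
    have h1 : Continuous fun τ ↦ log (L τ + charParity χ) :=
      (hLc.add continuous_const).clog fun τ ↦ by
        rw [mem_slitPlane_iff]; left; exact hrea τ
    have h4 := continuous_charPrimeLog_comp χ hLc hσ fun τ ↦ (hLre τ).symm.le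
    have h5 := continuous_charPrimeLog_comp χ (g := fun τ ↦ L τ + 2) (hLc.add continuous_const) hσ
      fun τ ↦ by simp [hL]
    exact ((continuous_const.sub h1)).add (h4.sub h5)
  have he : ∀ τ, cexp (u τ) = cexp (v τ) := by
    intro τ
    have h2 : L τ + 1 + 1 = L τ + 2 := by ring
    rw [hv, exp_psi χ (hre0 τ), hu]
    simp only
    rw [Complex.exp_add, exp_log (hf0 τ), exp_log (hf1 τ), hf]
    simp only [h2]
    have hx1 := dirichletXi_ne_zero χ (hre1 τ)
    have hx2 := dirichletXi_ne_zero χ (hre2 τ)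
    field_simp
  have hb : ∀ τ, |(u τ).im| ≤ Real.pi := by
    intro τ
    have h1 := abs_arg_le_pi_div_two_iff.2 (hpos0 τ)
    have h2 := abs_arg_le_pi_div_two_iff.2 (hpos1 τ)
    simp only [hu, add_im, log_im]
    refine (abs_add_le _ _).trans ?_
    linarith
  have hmain := ConreyLi2000.abs_im_sub_im_le_two_pi huc hvc he hb t t'
  -- peel off the argument, which lies in `(−π, π]`
  have hvim : ∀ τ, (v τ).im = -arg (L τ + charParity χ)
      + (charPrimeLog χ (L τ) - charPrimeLog χ (L τ + 2)).im := by
    intro τ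
    simp only [hv, add_im, sub_im, ofReal_im, log_im]
    ring
  rw [hvim, hvim] at hmain
  have a1 := neg_pi_lt_arg (L t + charParity χ); have a1' := arg_le_pi (L t + charParity χ)
  have b1 := neg_pi_lt_arg (L t' + charParity χ); have b1' := arg_le_pi (L t' + charParity χ)
  rw [abs_le] at hmain ⊢
  constructor <;> linarith [hmain.1, hmain.2]

/-! ### The prime side: termwise estimates -/

omit [NeZero N] in
/-- **Termwise comparison with the twisted prime Dirichlet series**: for `Re w > 1` and a prime `p`,
`‖(−log(1−χ(p)p^{−w}) + log(1−χ(p)p^{−(w+2)})) − χ(p)p^{−w}‖ ≤ 2 p^{−2}`. [folklore] -/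
private theorem norm_term_sub_le (p : Nat.Primes) {w : ℂ} (hw : 1 < w.re) :
    ‖(-log (1 - χ p * ((p : ℕ) : ℂ) ^ (-w)) - -log (1 - χ p * ((p : ℕ) : ℂ) ^ (-(w + 2))))
        - χ p * ((p : ℕ) : ℂ) ^ (-w)‖ ≤ 2 * ((p : ℕ) : ℝ) ^ (-2 : ℝ) := by
  set z : ℂ := χ p * ((p : ℕ) : ℂ) ^ (-w) with hz
  have hp1 : (1 : ℝ) ≤ ((p : ℕ) : ℝ) := by exact_mod_cast p.2.one_lt.le
  have hp2 : (2 : ℝ) ≤ ((p : ℕ) : ℝ) := by exact_mod_cast p.2.two_le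
  have hppos : (0 : ℝ) < ((p : ℕ) : ℝ) := by linarith
  have hz1 : ‖z‖ ≤ ((p : ℕ) : ℝ) ^ (-1 : ℝ) :=
    (norm_chi_mul_cpow_le χ p w).trans (Real.rpow_le_rpow_of_exponent_le hp1 (by linarith))
  have hz_half : ‖z‖ ≤ 2⁻¹ := by
    refine hz1.trans ?_
    rw [Real.rpow_neg_one]
    exact inv_anti₀ two_pos hp2
  have hP0 : 0 ≤ ((p : ℕ) : ℝ) ^ (-2 : ℝ) := Real.rpow_nonneg hppos.le _
  -- first piece: `‖-log(1-z) - z‖ ≤ ‖z‖² ≤ p⁻²`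
  have hA : ‖-log (1 - z) - z‖ ≤ ((p : ℕ) : ℝ) ^ (-2 : ℝ) := by
    have hlt : ‖-z‖ < 1 := by rw [norm_neg]; linarith
    have h1 := norm_log_one_add_sub_self_le hlt
    rw [norm_neg] at h1
    have e : -log (1 - z) - z = -(log (1 + -z) - -z) := by rw [sub_eq_add_neg 1 z]; ring
    rw [e, norm_neg]
    refine h1.trans ?_
    have hinv : (1 - ‖z‖)⁻¹ ≤ 2 := by
      rw [inv_le_comm₀ (by linarith) two_pos]
      linarith
    have hsq : ‖z‖ ^ 2 ≤ ((p : ℕ) : ℝ) ^ (-2 : ℝ) := by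
      have e2 : (((p : ℕ) : ℝ) ^ (-1 : ℝ)) ^ 2 = ((p : ℕ) : ℝ) ^ (-2 : ℝ) := by
        rw [← Real.rpow_natCast, ← Real.rpow_mul hppos.le]; norm_num
      rw [← e2]
      exact pow_le_pow_left₀ (norm_nonneg _) hz1 2
    calc ‖z‖ ^ 2 * (1 - ‖z‖)⁻¹ / 2 ≤ ‖z‖ ^ 2 * 2 / 2 := by gcongr
      _ = ‖z‖ ^ 2 := by ring
      _ ≤ _ := hsq
  -- second piece: `‖log(1 - χ(p)p^{-(w+2)})‖ ≤ (3/2) p⁻³ ≤ p⁻²`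
  have hB : ‖-log (1 - χ p * ((p : ℕ) : ℂ) ^ (-(w + 2)))‖ ≤ ((p : ℕ) : ℝ) ^ (-2 : ℝ) := by
    have h3 : (3 : ℝ) ≤ (w + 2).re := by simp only [add_re, re_ofNat]; linarith
    refine (norm_term_le χ p (by norm_num) h3).trans ?_
    have e : ((p : ℕ) : ℝ) ^ (-3 : ℝ) = ((p : ℕ) : ℝ) ^ (-2 : ℝ) * ((p : ℕ) : ℝ)⁻¹ := by
      rw [← Real.rpow_neg_one, ← Real.rpow_add hppos]; norm_num
    rw [e]
    have hpinv : ((p : ℕ) : ℝ)⁻¹ ≤ 2⁻¹ := inv_anti₀ two_pos hp2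
    nlinarith
  calc ‖(-log (1 - z) - -log (1 - χ p * ((p : ℕ) : ℂ) ^ (-(w + 2)))) - z‖
      = ‖(-log (1 - z) - z) - -log (1 - χ p * ((p : ℕ) : ℂ) ^ (-(w + 2)))‖ := by
        congr 1; ring
    _ ≤ ‖-log (1 - z) - z‖ + ‖-log (1 - χ p * ((p : ℕ) : ℂ) ^ (-(w + 2)))‖ := norm_sub_le _ _
    _ ≤ _ := by linarith

omit [NeZero N] in
/-- The main term on a vertical line: `Im(χ(p) p^{−(σ+it)}) = p^{−σ} · Im(χ(p) conj(p^{it}))`.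
[folklore] -/
private theorem im_chi_mul_cpow_line (p : Nat.Primes) (σ t : ℝ) :
    (χ p * ((p : ℕ) : ℂ) ^ (-((σ : ℂ) + t * I))).im
      = ((p : ℕ) : ℝ) ^ (-σ) * (χ p * conj (((p : ℕ) : ℂ) ^ ((t : ℂ) * I))).im := by
  have hp0 : ((p : ℕ) : ℂ) ≠ 0 := by exact_mod_cast p.2.ne_zero
  have harg : ((p : ℕ) : ℂ).arg ≠ Real.pi := by
    rw [natCast_arg]; exact Real.pi_ne_zero.symm
  have e1 : -((σ : ℂ) + t * I) = -(σ : ℂ) + conj ((t : ℂ) * I) := by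
    simp only [map_mul, conj_ofReal, conj_I]; ring
  have e2 : ((p : ℕ) : ℂ) ^ (-((σ : ℂ) + t * I))
      = ((((p : ℕ) : ℝ) ^ (-σ) : ℝ) : ℂ) * conj (((p : ℕ) : ℂ) ^ ((t : ℂ) * I)) := by
    rw [e1, cpow_add _ _ hp0, cpow_conj _ _ harg, map_natCast, primes_cpow_neg_ofReal]
  rw [e2, ← mul_assoc, mul_comm (χ p), mul_assoc, im_ofReal_mul]

/-- **Kronecker's alignment, read on the main term.** For `‖c‖ = 1` and `‖u − i c‖ < 1/2`
(`u = p^{it}` aligned with `i χ(p)`): `Im(c · conj u) < −1/2`. [folklore] -/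
private theorem im_mul_conj_lt {c u : ℂ} (hc : ‖c‖ = 1) (h : ‖u - I * c‖ < 1 / 2) :
    (c * conj u).im < -(1 / 2) := by
  have hcc : c * conj c = 1 := by
    rw [mul_conj', hc]; norm_num
  have key : c * conj u + I = c * conj (u - I * c) := by
    simp only [map_sub, map_mul, conj_I]
    linear_combination (-I) * hcc
  have hn : ‖c * conj u + I‖ < 1 / 2 := by
    rw [key, norm_mul, hc, one_mul, norm_conj]; exact h
  have hlt : |(c * conj u).im + 1| < 1 / 2 := by
    have := (abs_im_le_norm (c * conj u + I)).trans_lt hn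
    rwa [add_im, I_im] at this
  linarith [(abs_lt.1 hlt).2]

/-- The opposite alignment: for `‖c‖ = 1` and `‖u + i c‖ < 1/2`, `Im(c · conj u) > 1/2`. [folklore] -/
private theorem lt_im_mul_conj {c u : ℂ} (hc : ‖c‖ = 1) (h : ‖u - -(I * c)‖ < 1 / 2) :
    1 / 2 < (c * conj u).im := by
  have hcc : c * conj c = 1 := by
    rw [mul_conj', hc]; norm_num
  have key : c * conj u - I = c * conj (u - -(I * c)) := by
    simp only [map_sub, map_neg, map_mul, conj_I]
    linear_combination I * hcc
  have hn : ‖c * conj u - I‖ < 1 / 2 := by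
    rw [key, norm_mul, hc, one_mul, norm_conj]; exact h
  have hlt : |(c * conj u).im - 1| < 1 / 2 := by
    have := (abs_im_le_norm (c * conj u - I)).trans_lt hn
    rwa [sub_im, I_im] at this
  linarith [(abs_lt.1 hlt).1]

omit [NeZero N] in
/-- `|Im(χ(p) conj(p^{it}))| ≤ 1`. [folklore] -/
private theorem abs_im_chi_mul_conj_le (p : Nat.Primes) (t : ℝ) :
    |(χ p * conj (((p : ℕ) : ℂ) ^ ((t : ℂ) * I))).im| ≤ 1 := by
  refine (abs_im_le_norm _).trans ?_
  rw [norm_mul, norm_conj, norm_natCast_cpow_of_pos p.2.pos]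
  simp only [mul_re, ofReal_re, I_re, mul_zero, ofReal_im, I_im, mul_one, sub_self,
    Real.rpow_zero, mul_one]
  exact χ.norm_le_one _

omit [NeZero N] in
/-- For a prime `p ∤ r`, `‖χ(p)‖ = 1`; for `p ∣ r`, `χ(p) = 0`. [folklore] -/
private theorem norm_chi_prime (p : Nat.Primes) :
    (¬ (p : ℕ) ∣ N → ‖χ p‖ = 1) ∧ ((p : ℕ) ∣ N → χ p = 0) := by
  constructor
  · intro h
    exact χ.unit_norm_eq_one (ZMod.isUnit_prime_of_not_dvd p.2 h).unit
  · intro h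
    exact χ.map_nonunit (mt (ZMod.isUnit_prime_iff_not_dvd p.2).1 (not_not.2 h))

omit [NeZero N] in
/-- **Termwise lower bound for `Y(t₂) − Y(t₁)`.** With `T_p(s) = −log(1−χ(p)p^{−s}) + log(1−χ(p)p^{−s−2})`,
`s_j = σ + it_j` (`σ > 1`), and the alignments `Im(χ(p)conj p^{it₁}) < −1/2`, `Im(χ(p)conj p^{it₂}) > 1/2`
for the primes `p < n`, `p ∤ r`: `Im T_p(s₂) − Im T_p(s₁) ≥ p^{−σ} − 4p^{−2}` for those primes, and
`≥ −2p^{−σ} − 4p^{−2}` for every prime. [folklore] -/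
private theorem pointwise_bound (p : Nat.Primes) {σ : ℝ} (hσ : 1 < σ) (t₁ t₂ : ℝ) (A : Finset ℕ)
    (hA : (p : ℕ) ∈ A → ¬ (p : ℕ) ∣ N ∧
      (χ p * conj (((p : ℕ) : ℂ) ^ ((t₁ : ℂ) * I))).im < -(1 / 2) ∧
      1 / 2 < (χ p * conj (((p : ℕ) : ℂ) ^ ((t₂ : ℂ) * I))).im) :
    (if (p : ℕ) ∈ A then ((p : ℕ) : ℝ) ^ (-σ) else -2 * ((p : ℕ) : ℝ) ^ (-σ))
        - 4 * ((p : ℕ) : ℝ) ^ (-2 : ℝ)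
      ≤ (-log (1 - χ p * ((p : ℕ) : ℂ) ^ (-((σ : ℂ) + (t₂ : ℂ) * I)))
            - -log (1 - χ p * ((p : ℕ) : ℂ) ^ (-((σ : ℂ) + (t₂ : ℂ) * I + 2)))).im
        - (-log (1 - χ p * ((p : ℕ) : ℂ) ^ (-((σ : ℂ) + (t₁ : ℂ) * I)))
            - -log (1 - χ p * ((p : ℕ) : ℂ) ^ (-((σ : ℂ) + (t₁ : ℂ) * I + 2)))).im := by
  set s₁ : ℂ := (σ : ℂ) + (t₁ : ℂ) * I with hs₁
  set s₂ : ℂ := (σ : ℂ) + (t₂ : ℂ) * I with hs₂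
  have hs₁re : 1 < s₁.re := by simp [hs₁]; exact hσ
  have hs₂re : 1 < s₂.re := by simp [hs₂]; exact hσ
  have e1 := norm_term_sub_le χ p hs₁re
  have e2 := norm_term_sub_le χ p hs₂re
  have i1 := abs_le.1 ((abs_im_le_norm _).trans e1)
  have i2 := abs_le.1 ((abs_im_le_norm _).trans e2)
  rw [sub_im] at i1 i2
  have c1 : (χ p * ((p : ℕ) : ℂ) ^ (-s₁)).im
      = ((p : ℕ) : ℝ) ^ (-σ) * (χ p * conj (((p : ℕ) : ℂ) ^ ((t₁ : ℂ) * I))).im := by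
    rw [hs₁]; exact im_chi_mul_cpow_line χ p σ t₁
  have c2 : (χ p * ((p : ℕ) : ℂ) ^ (-s₂)).im
      = ((p : ℕ) : ℝ) ^ (-σ) * (χ p * conj (((p : ℕ) : ℂ) ^ ((t₂ : ℂ) * I))).im := by
    rw [hs₂]; exact im_chi_mul_cpow_line χ p σ t₂
  rw [c1] at i1
  rw [c2] at i2
  have hF0 : 0 ≤ ((p : ℕ) : ℝ) ^ (-σ) := Real.rpow_nonneg (Nat.cast_nonneg _) _
  have m1 := abs_le.1 (abs_im_chi_mul_conj_le χ p t₁)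
  have m2 := abs_le.1 (abs_im_chi_mul_conj_le χ p t₂)
  obtain ⟨i1a, i1b⟩ := i1
  obtain ⟨i2a, i2b⟩ := i2
  split_ifs with hpA
  · obtain ⟨-, h1, h2⟩ := hA hpA
    nlinarith
  · nlinarith

/-! ### The prime side: sums -/

omit [NeZero N] in
/-- `Im (E_χ(w) − E_χ(w+2)) = ∑_p Im T_p(w)` for `Re w > 1` (termwise, absolutely convergent).
[folklore] -/
private theorem im_charPrimeLog_sub_eq_tsum {w : ℂ} (hw : 1 < w.re) :
    (Summable fun p : Nat.Primes ↦
      (-log (1 - χ p * ((p : ℕ) : ℂ) ^ (-w)) - -log (1 - χ p * ((p : ℕ) : ℂ) ^ (-(w + 2)))).im) ∧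
    (charPrimeLog χ w - charPrimeLog χ (w + 2)).im =
      ∑' p : Nat.Primes,
        (-log (1 - χ p * ((p : ℕ) : ℂ) ^ (-w)) - -log (1 - χ p * ((p : ℕ) : ℂ) ^ (-(w + 2)))).im := by
  have hw2 : 1 < (w + 2).re := by simp only [add_re, re_ofNat]; linarith
  have h1 := summable_terms χ hw
  have h2 := summable_terms χ hw2
  have hD := h1.sub h2
  refine ⟨(Complex.hasSum_im hD.hasSum).summable, ?_⟩
  rw [charPrimeLog, charPrimeLog, ← Complex.im_tsum hD, h1.tsum_sub h2]

/-- The comparison series summed over a finite set `A` of primes: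
`∑_p [(p ∈ A ? p^{−σ} : −2p^{−σ}) − 4p^{−2}] = 3∑_{p∈A} p^{−σ} − 2S − 4C`
with `S = ∑_p p^{−σ}`, `C = ∑_p p^{−2}` (`σ > 1`). [folklore] -/
private theorem tsum_comparison_finset_eq {σ : ℝ} (hσ : 1 < σ) (A : Finset ℕ)
    (hAp : ∀ q ∈ A, q.Prime) :
    (Summable fun p : Nat.Primes ↦
      (if (p : ℕ) ∈ A then ((p : ℕ) : ℝ) ^ (-σ) else -2 * ((p : ℕ) : ℝ) ^ (-σ))
        - 4 * ((p : ℕ) : ℝ) ^ (-2 : ℝ)) ∧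
    ∑' p : Nat.Primes, ((if (p : ℕ) ∈ A then ((p : ℕ) : ℝ) ^ (-σ) else -2 * ((p : ℕ) : ℝ) ^ (-σ))
        - 4 * ((p : ℕ) : ℝ) ^ (-2 : ℝ)) =
      3 * ∑ p ∈ A, ((p : ℕ) : ℝ) ^ (-σ)
        - 2 * ∑' p : Nat.Primes, ((p : ℕ) : ℝ) ^ (-σ)
        - 4 * ∑' p : Nat.Primes, ((p : ℕ) : ℝ) ^ (-2 : ℝ) := by
  have hF := summable_primes_rpow_neg hσ
  have hF0 : ∀ p : Nat.Primes, 0 ≤ ((p : ℕ) : ℝ) ^ (-σ) := fun p ↦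
    Real.rpow_nonneg (Nat.cast_nonneg _) _
  have hC : Summable fun p : Nat.Primes ↦ ((p : ℕ) : ℝ) ^ (-2 : ℝ) :=
    LogEulerProduct.summable_primes_rpow_neg_two
  have hind : Summable fun p : Nat.Primes ↦ if (p : ℕ) ∈ A then ((p : ℕ) : ℝ) ^ (-σ) else 0 := by
    refine Summable.of_nonneg_of_le (fun p ↦ ?_) (fun p ↦ ?_) hF
    · split_ifs; exacts [hF0 p, le_rfl]
    · split_ifs; exacts [le_rfl, hF0 p]
  have hindval : ∑' p : Nat.Primes, (if (p : ℕ) ∈ A then ((p : ℕ) : ℝ) ^ (-σ) else 0)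
      = ∑ p ∈ A, ((p : ℕ) : ℝ) ^ (-σ) := by
    have h1 : (∑' p : Nat.Primes, if (p : ℕ) ∈ A then ((p : ℕ) : ℝ) ^ (-σ) else 0)
        = ∑' q : ℕ, {q : ℕ | q.Prime}.indicator (fun q : ℕ ↦ if q ∈ A then (q : ℝ) ^ (-σ) else 0) q :=
      tsum_subtype {q : ℕ | q.Prime} (fun q : ℕ ↦ if q ∈ A then (q : ℝ) ^ (-σ) else 0)
    rw [h1, tsum_eq_sum (s := A)]
    · refine Finset.sum_congr rfl fun q hq ↦ ?_
      have hqp : q.Prime := hAp q hq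
      simp [hqp, hq]
    · intro q hq
      by_cases hqp : q.Prime <;> simp [hqp, hq]
  have e : ∀ p : Nat.Primes,
      (if (p : ℕ) ∈ A then ((p : ℕ) : ℝ) ^ (-σ) else -2 * ((p : ℕ) : ℝ) ^ (-σ))
          - 4 * ((p : ℕ) : ℝ) ^ (-2 : ℝ)
        = 3 * (if (p : ℕ) ∈ A then ((p : ℕ) : ℝ) ^ (-σ) else 0) - 2 * ((p : ℕ) : ℝ) ^ (-σ)
          - 4 * ((p : ℕ) : ℝ) ^ (-2 : ℝ) := by
    intro p; split_ifs <;> ring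
  have hsum3 : Summable fun p : Nat.Primes ↦
      3 * (if (p : ℕ) ∈ A then ((p : ℕ) : ℝ) ^ (-σ) else 0) - 2 * ((p : ℕ) : ℝ) ^ (-σ)
        - 4 * ((p : ℕ) : ℝ) ^ (-2 : ℝ) :=
    ((hind.mul_left 3).sub (hF.mul_left 2)).sub (hC.mul_left 4)
  refine ⟨hsum3.congr fun p ↦ (e p).symm, ?_⟩
  rw [tsum_congr e, ((hind.mul_left 3).sub (hF.mul_left 2)).tsum_sub (hC.mul_left 4),
    (hind.mul_left 3).tsum_sub (hF.mul_left 2), tsum_mul_left, tsum_mul_left, tsum_mul_left,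
    hindval]

/-- The primes `p < n` dividing `r` contribute at most `r` to `∑_{p<n} p^{−σ}` (each term is `≤ 1`
and there are at most `#(divisors r) ≤ r` of them). [folklore] -/
private theorem sum_primesBelow_dvd_le {σ : ℝ} (hσ : 1 < σ) (n : ℕ) :
    ∑ p ∈ (Nat.primesBelow n).filter (· ∣ N), ((p : ℕ) : ℝ) ^ (-σ) ≤ N := by
  have hN : N ≠ 0 := NeZero.ne N
  have hsub : (Nat.primesBelow n).filter (· ∣ N) ⊆ N.divisors := by
    intro p hp
    rw [Finset.mem_filter] at hp
    exact Nat.mem_divisors.2 ⟨hp.2, hN⟩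
  calc ∑ p ∈ (Nat.primesBelow n).filter (· ∣ N), ((p : ℕ) : ℝ) ^ (-σ)
      ≤ ∑ p ∈ (Nat.primesBelow n).filter (· ∣ N), (1 : ℝ) := by
        refine Finset.sum_le_sum fun p hp ↦ ?_
        have hp1 : (1 : ℝ) ≤ p := by
          rw [Finset.mem_filter] at hp
          exact_mod_cast (Nat.prime_of_mem_primesBelow hp.1).one_lt.le
        exact Real.rpow_le_one_of_one_le_of_nonpos hp1 (by linarith)
    _ = ((Nat.primesBelow n).filter (· ∣ N)).card := by simp
    _ ≤ (N.divisors.card : ℝ) := by exact_mod_cast Finset.card_le_card hsub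
    _ ≤ N := by exact_mod_cast Nat.card_divisors_le_self N

/-- **The prime side is unbounded** (Bohr's method with Kronecker's theorem, twisted by `χ`): for
every `K` there are `σ > 1` and `t₁, t₂` with `Y(t₂) − Y(t₁) > K`, where
`Y(t) = Im (E_χ(σ+it) − E_χ(σ+it+2))`. [cite: Titchmarsh1986, §8.6] -/
theorem exists_im_charPrimeLog_osc (K : ℝ) :
    ∃ σ : ℝ, 1 < σ ∧ ∃ t₁ t₂ : ℝ,
      K < (charPrimeLog χ ((σ : ℂ) + (t₂ : ℂ) * I) - charPrimeLog χ ((σ : ℂ) + (t₂ : ℂ) * I + 2)).im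
          - (charPrimeLog χ ((σ : ℂ) + (t₁ : ℂ) * I)
              - charPrimeLog χ ((σ : ℂ) + (t₁ : ℂ) * I + 2)).im := by
  classical
  obtain ⟨σ, hσ, n, hH, hS⟩ :=
    ConreyLi2000.exists_sigma_n (K + 3 * N) (∑' p : Nat.Primes, ((p : ℕ) : ℝ) ^ (-2 : ℝ))
  -- the aligned set: primes below `n` not dividing `r`
  set A : Finset ℕ := (Nat.primesBelow n).filter (fun p ↦ ¬ p ∣ N) with hA_def
  have hAp : ∀ q ∈ A, q.Prime := fun q hq ↦
    Nat.prime_of_mem_primesBelow (Finset.mem_filter.1 hq).1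
  -- Kronecker targets `± i χ(p)` (and `1` at the primes dividing `r`)
  set ω₁ : ℕ → ℂ := fun p ↦ if p ∣ N then 1 else I * χ p with hω₁
  set ω₂ : ℕ → ℂ := fun p ↦ if p ∣ N then 1 else -(I * χ p) with hω₂
  have hω₁n : ∀ p, p.Prime → ‖ω₁ p‖ = 1 := by
    intro p hp
    simp only [hω₁]
    split_ifs with h
    · simp
    · rw [norm_mul, norm_I, one_mul]; exact (norm_chi_prime χ ⟨p, hp⟩).1 h
  have hω₂n : ∀ p, p.Prime → ‖ω₂ p‖ = 1 := by
    intro p hp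
    simp only [hω₂]
    split_ifs with h
    · simp
    · rw [norm_neg, norm_mul, norm_I, one_mul]; exact (norm_chi_prime χ ⟨p, hp⟩).1 h
  obtain ⟨t₁, -, ht₁⟩ := Kronecker.exists_abs_ge_forall_prime_norm_cpow_sub_lt n ω₁ hω₁n
    (by norm_num : (0 : ℝ) < 1 / 2) 0
  obtain ⟨t₂, -, ht₂⟩ := Kronecker.exists_abs_ge_forall_prime_norm_cpow_sub_lt n ω₂ hω₂n
    (by norm_num : (0 : ℝ) < 1 / 2) 0
  refine ⟨σ, hσ, t₁, t₂, ?_⟩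
  have hs₁ : 1 < ((σ : ℂ) + (t₁ : ℂ) * I).re := by simp; exact hσ
  have hs₂ : 1 < ((σ : ℂ) + (t₂ : ℂ) * I).re := by simp; exact hσ
  obtain ⟨hsum₁, heq₁⟩ := im_charPrimeLog_sub_eq_tsum χ hs₁
  obtain ⟨hsum₂, heq₂⟩ := im_charPrimeLog_sub_eq_tsum χ hs₂
  rw [heq₁, heq₂, ← hsum₂.tsum_sub hsum₁]
  obtain ⟨hGsum, hGval⟩ := tsum_comparison_finset_eq hσ A hAp
  -- the alignment hypotheses of `pointwise_bound`
  have hal : ∀ p : Nat.Primes, (p : ℕ) ∈ A → ¬ (p : ℕ) ∣ N ∧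
      (χ p * conj (((p : ℕ) : ℂ) ^ ((t₁ : ℂ) * I))).im < -(1 / 2) ∧
      1 / 2 < (χ p * conj (((p : ℕ) : ℂ) ^ ((t₂ : ℂ) * I))).im := by
    intro p hp
    obtain ⟨hpn, hpN⟩ := Finset.mem_filter.1 hp
    have hpn' : (p : ℕ) ≤ n := (Nat.mem_primesBelow.1 hpn).1.le
    have hc : ‖χ p‖ = 1 := (norm_chi_prime χ p).1 hpN
    have h1 := ht₁ p p.2 hpn'
    have h2 := ht₂ p p.2 hpn'
    simp only [hω₁, hω₂, hpN, if_false] at h1 h2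
    exact ⟨hpN, im_mul_conj_lt hc h1, lt_im_mul_conj hc h2⟩
  have hle := hGsum.tsum_le_tsum (fun p ↦ pointwise_bound χ p hσ t₁ t₂ A (hal p)) (hsum₂.sub hsum₁)
  rw [hGval] at hle
  -- `∑_{p ∈ A} p^{-σ} ≥ H − r`
  have hsplit : ∑ p ∈ Nat.primesBelow n, ((p : ℕ) : ℝ) ^ (-σ)
      = ∑ p ∈ A, ((p : ℕ) : ℝ) ^ (-σ)
        + ∑ p ∈ (Nat.primesBelow n).filter (· ∣ N), ((p : ℕ) : ℝ) ^ (-σ) := by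
    rw [hA_def, ← Finset.sum_filter_add_sum_filter_not (Nat.primesBelow n) (fun p ↦ ¬ p ∣ N)]
    congr 2
    ext p
    simp
  have hdvd := sum_primesBelow_dvd_le (N := N) hσ n
  linarith

end ConreyLi2000Char

/-! ### The discharge -/

/-- **Sarnak's statement for every Dirichlet character, with `Re s₀ > 1`.** For every `r ≥ 1` and
every `χ` mod `r` there is `s₀` with `Re s₀ > 1` and `Re{ξ(s₀, χ)/ξ(s₀+1, χ)} < 0`. Proof: otherwise
on a line `Re s = σ > 1` the twisted prime sum `Y(t) = Im(E_χ(σ+it) − E_χ(σ+it+2))` would oscillate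
by at most `4π` (`ConreyLi2000Char.abs_im_sub_im_le`), contradicting Kronecker's theorem and
`∑_{p ∤ r} 1/p = ∞` (`ConreyLi2000Char.exists_im_charPrimeLog_osc`). [cite: ConreyLi2000, §4 Remark] -/
theorem exists_re_dirichletXi_div_neg {N : ℕ} [NeZero N] (χ : DirichletCharacter ℂ N) :
    ∃ s₀ : ℂ, 1 < s₀.re ∧ (dirichletXi χ s₀ / dirichletXi χ (s₀ + 1)).re < 0 := by
  by_contra H
  have H0 : ∀ s : ℂ, 1 < s.re → 0 ≤ (dirichletXi χ s / dirichletXi χ (s + 1)).re := by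
    intro s hs
    by_contra h
    exact H ⟨s, hs, lt_of_not_ge h⟩
  obtain ⟨σ, hσ, t₁, t₂, hK⟩ := ConreyLi2000Char.exists_im_charPrimeLog_osc χ (4 * Real.pi)
  have h := ConreyLi2000Char.abs_im_sub_im_le χ H0 hσ t₂ t₁
  linarith [(abs_le.1 h).2]

/-- **Conrey–Li 2000, §4 Remark (P. Sarnak): de Branges' `𝓕(W_χ)`-positivity fails for every
Dirichlet `L`-function** — discharge of the named fact `ConreyLi2000_FW_char`
(`DeBrangesPositivityDirichlet.lean`): for every `r ≥ 1` and every Dirichlet character `χ` mod `r`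
there is `s₀` with `Re s₀ > 1/2` and `Re{ξ(s₀, χ)/ξ(s₀+1, χ)} < 0` (indeed with `Re s₀ > 1`,
`exists_re_dirichletXi_div_neg`). [cite: ConreyLi2000, §4 Remark] -/
theorem ConreyLi2000_FW_char_holds : ConreyLi2000_FW_char := by
  intro r _ χ
  obtain ⟨s₀, hs₀, hneg⟩ := exists_re_dirichletXi_div_neg χ
  exact ⟨s₀, by linarith, hneg⟩

/-- The Dirichlet barrier `DeBrangesPositivityDirichlet` from its remaining numerical component
(the `χ₄` zero test (3.7), `ConreyLi2000_HE_chi4`), the `𝓕(W_χ)` half being proved.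
[cite: ConreyLi2000, §3.2 and §4] -/
theorem DeBrangesPositivityDirichlet_of_HE_chi4 (h : ConreyLi2000_HE_chi4) :
    DeBrangesPositivityDirichlet :=
  ⟨h, ConreyLi2000_FW_char_holds⟩

/-- **Conrey–Li 2000, §4 (Sarnak), the printed conclusion, GIVEN Theorem 2**: for every Dirichlet
character `χ` mod `r ≥ 1`, the space `𝓕(W_χ)`, `W_χ(z) = 1/ξ(1 − iz, χ)`, does NOT satisfy de Branges'
positivity condition (3.8): no linear transformation `T` of `𝓕(W_χ)` into itself with
`T K(w, ·) = K(w+i, ·)` has `Re⟨F, TF⟩_{𝓕(W_χ)} ≥ 0` for all `F ∈ 𝓕(W_χ)`. Here Theorem 2 is the named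
fact `Literature.Analysis.DeBrangesSpaces.conreyLi2000_thm2` (its proof is not in the tree); the
failure of its necessary condition is `exists_re_dirichletXi_div_neg` (`s₀` with `Re s₀ > 1`, i.e.
`z₀ = i(s₀ − 1)` in the OPEN upper half-plane, `W_χ(z₀)/W_χ(z₀+i) = ξ(s₀+1, χ)/ξ(s₀, χ)`).
[cite: ConreyLi2000, §4 Remark] -/
theorem not_positivity_spaceF_char (h2 : Literature.Analysis.DeBrangesSpaces.conreyLi2000_thm2)
    {N : ℕ} [NeZero N] (χ : DirichletCharacter ℂ N) {T : (ℂ → ℂ) → (ℂ → ℂ)}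
    (hT : Literature.Analysis.DeBrangesSpaces.SpaceF.IsKernelShift
      (fun z ↦ (dirichletXi χ (1 - I * z))⁻¹) T) :
    ¬ ∀ F : ℂ → ℂ, Literature.Analysis.DeBrangesSpaces.SpaceF.Mem (fun z ↦ (dirichletXi χ (1 - I * z))⁻¹) F →
        0 ≤ (Literature.Analysis.DeBrangesSpaces.SpaceF.inner
          (fun z ↦ (dirichletXi χ (1 - I * z))⁻¹) F (T F)).re := by
  intro hpos
  have hres : ∀ z : ℂ, (1 - I * z).re = 1 + z.im := by intro z; simp
  have hre_of : ∀ z : ℂ, 0 < z.im → 1 < (1 - I * z).re := fun z hz ↦ by rw [hres]; linarith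
  have hWd : DifferentiableOn ℂ (fun z ↦ (dirichletXi χ (1 - I * z))⁻¹) {z : ℂ | 0 < z.im} := by
    intro z hz
    have hs := hre_of z hz
    refine DifferentiableAt.differentiableWithinAt ?_
    have hlin : DifferentiableAt ℂ (fun z : ℂ ↦ 1 - I * z) z := by fun_prop
    have hcomp : DifferentiableAt ℂ (dirichletXi χ ∘ fun z : ℂ ↦ 1 - I * z) z :=
      DifferentiableAt.comp z (ConreyLi2000Char.differentiableAt_dirichletXi_of_one_lt_re χ hs) hlin
    exact hcomp.inv (ConreyLi2000Char.dirichletXi_ne_zero χ hs)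
  have hW0 : ∀ z : ℂ, 0 < z.im → (fun z ↦ (dirichletXi χ (1 - I * z))⁻¹) z ≠ 0 := fun z hz ↦
    inv_ne_zero (ConreyLi2000Char.dirichletXi_ne_zero χ (hre_of z hz))
  obtain ⟨s₀, hs₀, hneg⟩ := exists_re_dirichletXi_div_neg χ
  have hz₀ : 0 < (I * (s₀ - 1)).im := by simp; linarith
  have hge := Literature.Analysis.DeBrangesSpaces.conreyLi2000_thm2.re_div_nonneg_of_im_pos h2 hWd
    hW0 hT hpos hz₀
  have e0 : 1 - I * (I * (s₀ - 1)) = s₀ := by linear_combination (1 - s₀) * I_mul_I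
  have e1 : 1 - I * (I * (s₀ - 1) + I) = s₀ + 1 := by linear_combination (-s₀) * I_mul_I
  simp only [e0, e1, inv_div_inv] at hge
  -- `Re{ξ(s₀+1)/ξ(s₀)} ≥ 0` contradicts `Re{ξ(s₀)/ξ(s₀+1)} < 0`
  rw [← inv_div, inv_re] at hge
  have hpos' : 0 < normSq (dirichletXi χ s₀ / dirichletXi χ (s₀ + 1)) := by
    rw [normSq_pos]
    intro h0
    rw [h0] at hneg
    simp at hneg
  rcases div_nonneg_iff.mp hge with ⟨ha, _⟩ | ⟨_, hb⟩
  · linarith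
  · linarith

end Literature.Barriers.RiemannHypothesis

end
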